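import Literature.Analysis.FluidPDE.AncientMildCompactness
import Literature.Analysis.FluidPDE.BoundedMildSmoothRemainder
import Literature.Analysis.FluidPDE.NSBoundedMildSmoothing
import Literature.Analysis.FluidPDE.DerivativeHolderInterpolation
import Literature.Analysis.FluidPDE.TaoEnstrophyLocalisation
import Literature.Analysis.FluidPDE.KNSSRegularityGalilean
import HarnessLib

/-!
# KNSS 2009, Lemma 6.1 with vorticity: bounded Oseen-mild sequences on growing windows have a
# subsequence whose VORTICITIES converge pointwise on every negative slice

Topic `Analysis/FluidPDE`; companion of `AncientMildCompactness` (`KNSS2009_lemma61_oseenMild`: the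
`C⁰_loc` extraction of Koch–Nadirashvili–Seregin–Šverák 2009, Lemma 6.1) and of
`BoundedMildSmoothRemainder` (KNSS §4 regularity of bounded Oseen solutions on a window). Blow-up
arguments in the vorticity formulation (Giga–Miura 2011 §2.1, Prop. 2.2: "a subsequence `(u_k, ω_k)`
converges to some bounded continuous functions `(u, ω)` locally uniformly"; Seregin–Šverák 2009 §2) need
the rescaled VORTICITIES to converge as well. This file adds that upgrade for BOUNDED (not necessarily
Type-I) sequences, with no hypothesis beyond those of Lemma 6.1:

* `exists_iteratedFDeriv_bound_of_bounded_oseenMild` — KNSS (4.10) made window-uniform: for `B` and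
  `k` there is ONE constant `K` such that every continuous Oseen-mild field bounded by `B` on a window
  `(A, 0)` has `C^∞` slices with `‖Dᵏu(t)‖ ≤ K` at every time `t ∈ (A + 1, 0)` (unit windows slid
  along the time axis; `KNSS2009_mild_regularity_holds` with `N = B`, `T = 1`, `δ = ¼`);
* **`exists_ancientMild_limit_curl_tendsto`** — for continuous Oseen-mild fields `w_k` on `(A_k, 0)`,
  `A_k → −∞`, with weakly divergence-free slices and a common bound `B`, there are a subsequence `φ`
  and a bounded continuous Oseen-mild ancient field `W` (the limit of Lemma 6.1: continuous on
  `(−∞,0) × ℝ³`, weakly divergence free, `|W| ≤ B`, the Oseen identity for all `s < t < 0`) with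
  `C^∞` slices obeying the uniform bounds `‖DᵏW(t)‖ ≤ K_k` for ALL `t < 0`, such that
  `w_{φ(j)}(t, x) → W(t, x)` AND `curl w_{φ(j)}(t)(x) → curl W(t)(x)` for every `t < 0`, `x`
  (locally uniform convergence of the slices from Lemma 6.1, uniform second-derivative bounds, and
  Landau's two-function interpolation inequality `DerivInterp.norm_iteratedFDeriv_succ_sub_le`).

## References

* G. Koch, N. Nadirashvili, G. Seregin, V. Šverák, Acta Math. 203 (2009) 83–105 = arXiv:0709.3599:
  Lemma 6.1 (p. 11), §4 (4.10)–(4.11) with Prop. 4.1 (p. 8). [KochNadirashviliSereginSverak2009]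
* Y. Giga, H. Miura, Comm. Math. Phys. 303 (2011) 289–300 = HUPS #956, §2.1 p. 6 (convergence of
  `(u_k, ω_k)`). [GigaMiura2011]
-/

noncomputable section

open MeasureTheory Set Function Filter TopologicalSpace Metric
open _root_.Topology
open scoped ContDiff

namespace Literature.Analysis.FluidPDE

open UnboundedOperators

variable {A B : ℝ} {u : ℝ → EuclideanSpace ℝ (Fin 3) → EuclideanSpace ℝ (Fin 3)}

/-! ### Window-uniform derivative bounds for bounded Oseen-mild fields (KNSS (4.10)) -/

/-- **Sliding unit windows.** For a continuous Oseen-mild field `u` on `(A, 0) × ℝ³` bounded by `B`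
with weakly divergence-free slices, and a time `t` with `A + 1 < t < 0`, the translate
`v(τ) = u(τ + a)` with `a = t − ½` (if `t < −½`) or `a = t/2 − 1` (if `−½ ≤ t`) is a bounded Oseen
solution on the closed forward window `[0, 1]`, and `t` sits at the forward time `τ = t − a ∈ (¼, 1)`.
Returns the window start `a` with its bookkeeping. [folklore] -/
private theorem exists_slidingUnitWindow {t : ℝ} (hA : A + 1 < t) (ht : t < 0) :
    ∃ a : ℝ, A < a ∧ a + 1 < 0 ∧ 1 / 4 < t - a ∧ t - a < 1 := by
  rcases lt_or_ge t (-1 / 2) with h | h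
  · exact ⟨t - 1 / 2, by linarith, by linarith, by linarith, by linarith⟩
  · exact ⟨t / 2 - 1, by linarith, by linarith, by linarith, by linarith⟩

/-- **The translate of a bounded Oseen-mild field onto a forward unit window is drift-mild** (KNSS
2009 §4 (i), via `isKNSSDriftMild_clamp_of_oseenForward`): for `[a, a + 1] ⊂ (A, 0)` the field
`v(τ, x) = u(τ + a, x)` clamped to `[0, 1]` satisfies `IsKNSSDriftMild 1 B · 0`.
[cite: KochNadirashviliSereginSverak2009, §4 (i) (arXiv:0709.3599v1 p. 8)] -/
theorem isKNSSDriftMild_clamp_translate (hc : ContinuousOn (uncurry u) (Ioo A 0 ×ˢ univ))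
    (hdiv : ∀ t ∈ Ioo A 0, IsWeaklyDivFree (u t))
    (hmild : ∀ s t : ℝ, A < s → s < t → t < 0 → ∀ x,
      u t x = heatExtension (u s) (t - s) x - oseenDuhamel 1 s u u t x)
    (hB : ∀ t ∈ Ioo A 0, ∀ x, ‖u t x‖ ≤ B) {a : ℝ} (hAa : A < a) (ha1 : a + 1 < 0) :
    IsKNSSDriftMild 1 B (fun τ x => (fun σ y => u (σ + a) y) (max 0 (min τ 1)) x) 0 := by
  have hwin : ∀ τ ∈ Icc (0 : ℝ) 1, τ + a ∈ Ioo A 0 := fun τ hτ =>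
    ⟨by linarith [hτ.1], by linarith [hτ.2]⟩
  refine isKNSSDriftMild_clamp_of_oseenForward one_pos ?_ (fun τ hτ x => hB _ (hwin τ hτ) x)
    (fun τ hτ => hdiv _ (hwin τ hτ)) ?_
  · -- continuity of the translate on `[0, 1] × ℝ³`
    have hmap : Continuous fun p : ℝ × EuclideanSpace ℝ (Fin 3) => (p.1 + a, p.2) :=
      (continuous_fst.add continuous_const).prodMk continuous_snd
    have hinto : MapsTo (fun p : ℝ × EuclideanSpace ℝ (Fin 3) => (p.1 + a, p.2))
        (Icc (0 : ℝ) 1 ×ˢ univ) (Ioo A 0 ×ˢ univ) := by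
      rintro ⟨τ, x⟩ ⟨hτ, -⟩
      exact ⟨hwin τ hτ, mem_univ _⟩
    exact (hc.comp hmap.continuousOn hinto).congr fun p _ => rfl
  · -- the Oseen identity of the translate
    intro s τ hs hsτ hτ x
    have h := hmild (s + a) (τ + a) (by linarith) (by linarith) (by linarith) x
    rw [oseenDuhamel_translate 1 s a u u τ x]
    rw [show τ + a - (s + a) = τ - s by ring] at h
    exact h

/-- **KNSS (4.10), window-uniform**: for `B` and `k` there is `K` such that every continuous
Oseen-mild field on some `(A, 0) × ℝ³`, bounded by `B`, with weakly divergence-free slices, has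
`C^∞` slices `u(t)` with `‖Dᵏu(t)(x)‖ ≤ K` for all `t ∈ (A + 1, 0)` and all `x` (the constant of
`KNSS2009_mild_regularity_holds` for `N = B`, `T = 1`, `δ = ¼`, read on sliding unit windows).
[cite: KochNadirashviliSereginSverak2009, §4 (4.10) with Prop. 4.1 (arXiv:0709.3599v1 p. 8)] -/
theorem exists_iteratedFDeriv_bound_of_bounded_oseenMild (B : ℝ) (k : ℕ) :
    ∃ K : ℝ, ∀ ⦃A : ℝ⦄ ⦃u : ℝ → EuclideanSpace ℝ (Fin 3) → EuclideanSpace ℝ (Fin 3)⦄,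
      ContinuousOn (uncurry u) (Ioo A 0 ×ˢ univ) →
      (∀ t ∈ Ioo A 0, IsWeaklyDivFree (u t)) →
      (∀ s t : ℝ, A < s → s < t → t < 0 → ∀ x,
        u t x = heatExtension (u s) (t - s) x - oseenDuhamel 1 s u u t x) →
      (∀ t ∈ Ioo A 0, ∀ x, ‖u t x‖ ≤ B) →
      ∀ t : ℝ, A + 1 < t → t < 0 → ContDiff ℝ ∞ (u t) ∧ ∀ x, ‖iteratedFDeriv ℝ k (u t) x‖ ≤ K := by
  obtain ⟨C, L, hCL⟩ := KNSS2009_mild_regularity_holds B 1 one_pos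
  refine ⟨C k (1 / 4), fun A u hc hdiv hmild hB t hAt ht => ?_⟩
  obtain ⟨a, hAa, ha1, hτ1, hτ2⟩ := exists_slidingUnitWindow hAt ht
  have hV := isKNSSDriftMild_clamp_translate hc hdiv hmild hB hAa ha1
  obtain ⟨hsm, -, hCk, -, -⟩ := hCL hV
  have hτmem : t - a ∈ Ioo (0 : ℝ) 1 := ⟨by linarith, hτ2⟩
  have hτδ : t - a ∈ Ioo (1 / 4 : ℝ) 1 := ⟨hτ1, hτ2⟩
  -- the clamped translate at the forward time `t − a` is the slice `u t`
  have hfun : (fun x => (fun σ y => u (σ + a) y) (max 0 (min (t - a) 1)) x) = u t := by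
    funext x
    have h1 : max 0 (min (t - a) 1) = t - a := by
      rw [min_eq_left hτmem.2.le, max_eq_right hτmem.1.le]
    simp only [h1, sub_add_cancel]
  refine ⟨?_, fun x => ?_⟩
  · have h := hsm (t - a) hτmem
    rwa [hfun] at h
  · have h := hCk (1 / 4) (by norm_num) k (t - a) hτδ x
    rwa [hfun] at h

/-! ### Lemma 6.1 with vorticity -/

/-- **KNSS 2009, Lemma 6.1, with pointwise convergence of the vorticities** (Giga–Miura 2011, §2.1
p. 6: "a subsequence of solutions `(u_k, ω_k)` converges to some bounded continuous functions `(u, ω)`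
locally uniformly"). Let `w_k` be continuous Oseen-mild fields on `(A_k, 0) × ℝ³`, `A_k → −∞`, with
weakly divergence-free slices and the common bound `‖w_k‖ ≤ B`. Then there are a subsequence `φ` and a
field `W` — continuous on `(−∞, 0) × ℝ³`, with weakly divergence-free slices, `‖W‖ ≤ B`, satisfying
the Oseen identity for all `s < t < 0`, with `C^∞` slices obeying uniform bounds `‖DᵏW(t)‖ ≤ K_k` for
ALL `t < 0` — such that for every `t < 0` and `x`: `w_{φ(j)}(t, x) → W(t, x)` and
`curl w_{φ(j)}(t)(x) → curl W(t)(x)`. Proof: the `C⁰_loc` extraction `KNSS2009_lemma61_oseenMild`;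
window-uniform second-derivative bounds for the `w_k` and for `W`
(`exists_iteratedFDeriv_bound_of_bounded_oseenMild`); Landau's two-function inequality
`‖∇f − ∇g‖ ≤ 2 sup|f − g|/ρ + 2Kρ` on balls (`DerivInterp.norm_iteratedFDeriv_succ_sub_le`) turns
locally uniform convergence of the slices into convergence of the gradients, hence of the curls
(`‖curl‖ ≤ ‖curlCLM‖‖∇‖`). [cite: KochNadirashviliSereginSverak2009, Lemma 6.1 (arXiv:0709.3599v1 p. 11) with §4 (4.10)] -/
theorem exists_ancientMild_limit_curl_tendsto {Ak : ℕ → ℝ}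
    {w : ℕ → ℝ → EuclideanSpace ℝ (Fin 3) → EuclideanSpace ℝ (Fin 3)} {B : ℝ}
    (hA : Tendsto Ak atTop atBot)
    (hcont : ∀ k, ContinuousOn (uncurry (w k)) (Ioo (Ak k) 0 ×ˢ univ))
    (hdiv : ∀ k, ∀ t ∈ Ioo (Ak k) 0, IsWeaklyDivFree (w k t))
    (hmild : ∀ k, ∀ s t : ℝ, Ak k < s → s < t → t < 0 → ∀ x,
      w k t x = heatExtension (w k s) (t - s) x - oseenDuhamel 1 s (w k) (w k) t x)
    (hbdd : ∀ k, ∀ τ ∈ Ioo (Ak k) 0, ∀ x, ‖w k τ x‖ ≤ B) :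
    ∃ (φ : ℕ → ℕ) (W : ℝ → EuclideanSpace ℝ (Fin 3) → EuclideanSpace ℝ (Fin 3)), StrictMono φ ∧
      ContinuousOn (uncurry W) (Iio 0 ×ˢ univ) ∧
      (∀ t < 0, IsWeaklyDivFree (W t)) ∧
      (∀ t < 0, ∀ x, ‖W t x‖ ≤ B) ∧
      (∀ s t : ℝ, s < t → t < 0 → ∀ x,
        W t x = heatExtension (W s) (t - s) x - oseenDuhamel 1 s W W t x) ∧
      (∀ t < 0, ContDiff ℝ ∞ (W t)) ∧
      (∀ k : ℕ, ∃ K : ℝ, ∀ t < 0, ∀ x, ‖iteratedFDeriv ℝ k (W t) x‖ ≤ K) ∧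
      (∀ t < 0, ∀ x, Tendsto (fun j => w (φ j) t x) atTop (𝓝 (W t x))) ∧
      (∀ t < 0, ∀ x, Tendsto (fun j => curl (w (φ j) t) x) atTop (𝓝 (curl (W t) x))) := by
  obtain ⟨φ, W, hφ, hWc, hWdiv, hWbd, hWmild, -, hpt, hloc⟩ :=
    KNSS2009_lemma61_oseenMild hA hcont hdiv hmild hbdd
  -- `W` is a bounded Oseen-mild field on every window `(a, 0)`
  have hWwin : ∀ a : ℝ, ContinuousOn (uncurry W) (Ioo a 0 ×ˢ univ) := fun a =>
    hWc.mono (prod_mono Ioo_subset_Iio_self le_rfl)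
  have hWdiv' : ∀ a : ℝ, ∀ t ∈ Ioo a 0, IsWeaklyDivFree (W t) := fun a t ht => hWdiv t ht.2
  have hWmild' : ∀ a : ℝ, ∀ s t : ℝ, a < s → s < t → t < 0 → ∀ x,
      W t x = heatExtension (W s) (t - s) x - oseenDuhamel 1 s W W t x :=
    fun a s t _ hst ht x => hWmild s t hst ht x
  have hWbd' : ∀ a : ℝ, ∀ t ∈ Ioo a 0, ∀ x, ‖W t x‖ ≤ B := fun a t ht x => hWbd t ht.2 x
  -- uniform derivative bounds for `W` and smoothness of its slices
  have hWreg : ∀ k : ℕ, ∃ K : ℝ, ∀ t < 0, ContDiff ℝ ∞ (W t) ∧ ∀ x, ‖iteratedFDeriv ℝ k (W t) x‖ ≤ K := by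
    intro k
    obtain ⟨K, hK⟩ := exists_iteratedFDeriv_bound_of_bounded_oseenMild B k
    refine ⟨K, fun t ht => ?_⟩
    exact hK (hWwin (t - 2)) (hWdiv' (t - 2)) (hWmild' (t - 2)) (hWbd' (t - 2)) t (by linarith) ht
  have hWsm : ∀ t < 0, ContDiff ℝ ∞ (W t) := fun t ht => by
    obtain ⟨K, hK⟩ := hWreg 0
    exact (hK t ht).1
  refine ⟨φ, W, hφ, hWc, hWdiv, hWbd, hWmild, hWsm, fun k => ?_, hpt, fun t ht x => ?_⟩
  · obtain ⟨K, hK⟩ := hWreg k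
    exact ⟨K, fun t ht x => (hK t ht).2 x⟩
  -- ### curl convergence at `(t, x)` by Landau's inequality on `ball x 1`
  obtain ⟨K₂, hK₂⟩ := exists_iteratedFDeriv_bound_of_bounded_oseenMild B 2
  -- the second-derivative bound for `W t` and for the `w (φ j) t`, `j` large
  have hWK : ContDiff ℝ ∞ (W t) ∧ ∀ y, ‖iteratedFDeriv ℝ 2 (W t) y‖ ≤ K₂ :=
    hK₂ (hWwin (t - 2)) (hWdiv' (t - 2)) (hWmild' (t - 2)) (hWbd' (t - 2)) t (by linarith) ht
  have hφt : Tendsto φ atTop atTop := hφ.tendsto_atTop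
  have hjA : ∀ᶠ j in atTop, Ak (φ j) + 1 < t := by
    have h := (hA.comp hφt).eventually (eventually_lt_atBot (t - 1))
    filter_upwards [h] with j hj
    have hj' : Ak (φ j) < t - 1 := hj
    linarith
  have hwK : ∀ᶠ j in atTop, ContDiff ℝ ∞ (w (φ j) t) ∧
      ∀ y, ‖iteratedFDeriv ℝ 2 (w (φ j) t) y‖ ≤ K₂ := by
    filter_upwards [hjA] with j hj
    exact hK₂ (hcont (φ j)) (hdiv (φ j)) (hmild (φ j)) (hbdd (φ j)) t hj ht
  have hK₂0 : 0 ≤ K₂ := (norm_nonneg _).trans (hWK.2 x)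
  -- locally uniform convergence of the slices gives uniform convergence on `closedBall x 1`
  have hunif : TendstoUniformlyOn (fun j => w (φ j) t) (W t) atTop (closedBall x 1) :=
    (tendstoLocallyUniformly_iff_forall_isCompact.1 (hloc t ht)) (closedBall x 1)
      (isCompact_closedBall x 1)
  have hL0 : (0 : ℝ) ≤ ‖curlCLM‖ := norm_nonneg curlCLM
  refine Metric.tendsto_atTop.2 fun ε hε => ?_
  obtain ⟨ε', hε'0, hε'⟩ : ∃ ε' : ℝ, 0 < ε' ∧ ‖curlCLM‖ * ε' < ε :=
    ⟨ε / (‖curlCLM‖ + 1), by positivity, by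
      rw [mul_div_assoc', div_lt_iff₀ (by positivity)]; nlinarith⟩
  obtain ⟨ρ, hρ0, hρ1, hρK⟩ : ∃ ρ : ℝ, 0 < ρ ∧ ρ < 1 ∧ 2 * K₂ * ρ ≤ ε' / 4 := by
    refine ⟨min (1 / 2) (ε' / (8 * (K₂ + 1))), lt_min (by norm_num) (by positivity),
      lt_of_le_of_lt (min_le_left _ _) (by norm_num), ?_⟩
    calc 2 * K₂ * min (1 / 2) (ε' / (8 * (K₂ + 1))) ≤ 2 * K₂ * (ε' / (8 * (K₂ + 1))) := by
          gcongr; exact min_le_right _ _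
      _ = ε' / 4 * (K₂ / (K₂ + 1)) := by field_simp; ring
      _ ≤ ε' / 4 * 1 := by gcongr; exact (div_le_one (by positivity)).2 (by linarith)
      _ = ε' / 4 := mul_one _
  set a : ℝ := ε' * ρ / 8 with hadef
  have ha0 : 0 < a := by positivity
  have haρ : 2 * a / ρ = ε' / 4 := by rw [hadef]; field_simp; ring
  have hU : ∀ᶠ j in atTop, ∀ y ∈ closedBall x 1, dist (W t y) (w (φ j) t y) < a :=
    Metric.tendstoUniformlyOn_iff.1 hunif a ha0
  obtain ⟨N, hN⟩ := eventually_atTop.1 (hU.and hwK)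
  refine ⟨N, fun j hj => ?_⟩
  obtain ⟨hUj, hwKj⟩ := hN j hj
  -- Landau between `w (φ j) t` and `W t` on `ball x 1`
  have hI1 : ‖iteratedFDeriv ℝ (0 + 1) (w (φ j) t) x - iteratedFDeriv ℝ (0 + 1) (W t) x‖ ≤
      2 * a / ρ + 2 * K₂ * ρ := by
    refine DerivInterp.norm_iteratedFDeriv_succ_sub_le (N := ((⊤ : ℕ∞) : WithTop ℕ∞))
      (h := 1) (fun y _ => hwKj.1.contDiffAt) (fun y _ => hWK.1.contDiffAt)
      (by rw [← WithTop.coe_natCast]; exact WithTop.coe_le_coe.2 le_top)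
      (fun y hy => ?_) hK₂0 (fun y _ => hwKj.2 y) (fun y _ => hWK.2 y) hρ0 hρ1
    rw [DerivInterp.norm_iteratedFDeriv_zero_sub]
    have h := hUj y (ball_subset_closedBall hy)
    rw [dist_comm, dist_eq_norm] at h
    exact h.le
  have hD : ‖fderiv ℝ (w (φ j) t) x - fderiv ℝ (W t) x‖ ≤ ε' / 2 := by
    rw [norm_fderiv_sub_eq_norm_iteratedFDeriv_one_sub]
    refine hI1.trans ?_
    rw [haρ]
    linarith
  rw [dist_eq_norm, curl_eq_curlCLM, curl_eq_curlCLM, ← map_sub]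
  calc ‖curlCLM (fderiv ℝ (w (φ j) t) x - fderiv ℝ (W t) x)‖
      ≤ ‖curlCLM‖ * ‖fderiv ℝ (w (φ j) t) x - fderiv ℝ (W t) x‖ := curlCLM.le_opNorm _
    _ ≤ ‖curlCLM‖ * (ε' / 2) := by gcongr
    _ < ε := by nlinarith

end Literature.Analysis.FluidPDE

end
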